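import Mathlib.RingTheory.Polynomial.UniqueFactorization
import Literature.Computability.AlgebraicComplexity.PermanentIrreducible
import HarnessLib

/-!
# The generic determinant is an irreducible polynomial

Topic `Literature/Computability/AlgebraicComplexity`; companion of `PermanentIrreducible.lean`
(von zur Gathen 1987, Thm. 3.4 for the permanent). The generic determinant
`detPoly n R = det (X_{ij})` (`StandardFamilies.lean`) in the `n²` variables `X_{ij}` over an
integral domain `R` is irreducible as soon as `n` is non-empty (`detPoly_irreducible`); over a field
it is therefore a prime element of the factorial ring `R[X_{ij}]` (`detPoly_prime`).

This is classical (e.g. N. Jacobson, *Basic Algebra I*, 2nd ed. (1985), §7.2, Thm. 7.2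
"`det(x_{ij})` is irreducible (prime) in `F[x_{ij}]`"; J. von zur Gathen, *Permanent and
determinant*, Linear Algebra Appl. 96 (1987), proof of Thm. 3.4, deduces the characteristic-`2` case
of the permanent from it). The proof given here is the support argument of
`PermanentIrreducible.lean` verbatim — it only uses that the support of the polynomial is the set
of permutation monomials `X^{μ_ρ} = ∏_i X_{ρ i, i}`, on which the coefficients (`sign ρ = ±1`) are
nonzero: if `g h = det`, every variable has degree `1` in `det` and so lies in exactly one of
`vars g`, `vars h`; the "hybrid" exponents `μ_π|_{vars g} + μ_{π'}|_{vars h}` again carry a nonzero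
coefficient of `g h`, hence are permutation monomials, which forces `vars g` to be a union of full
rows and of full columns, i.e. empty or everything.

It is used in `Literature/NumberTheory/DiophantineGeometry/KroneckerRectangularStability.lean`
(a form vanishing on the singular matrices is divisible by the determinant), through
`irreducible_det_of_X` / `prime_det_of_X`: the determinant of a square matrix of distinct variables
`X (ι (i, j))` inside any larger polynomial ring is irreducible (prime over a field).

## References

* N. Jacobson, *Basic Algebra I*, 2nd ed., Freeman (1985), §7.2. [folklore]
* J. von zur Gathen, *Permanent and determinant*, Linear Algebra Appl. 96 (1987) 87–100, Thm. 3.4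
  (key `Vonzurgathen1987`).
-/

noncomputable section

namespace Literature.Computability.AlgebraicComplexity

open MvPolynomial

/-! ### Coefficients of the generic determinant -/

section Coeffs

variable {n : Type*} [Fintype n] [DecidableEq n] (R : Type*) [CommRing R]

/-- `det = ∑_ρ sign(ρ) X^{μ_ρ}` (Leibniz; Bürgisser 2000, (2.1)). [folklore] -/
theorem detPoly_eq_sum_monomial :
    detPoly n R = ∑ ρ : Equiv.Perm n,
      monomial (permMonomial ρ) (((Equiv.Perm.sign ρ : ℤˣ) : ℤ) : R) := by
  unfold detPoly
  rw [Matrix.det_apply']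
  refine Finset.sum_congr rfl fun ρ _ => ?_
  have hprod : (∏ i, Matrix.mvPolynomialX n n R (ρ i) i) = monomial (permMonomial ρ) (1 : R) := by
    rw [permMonomial, monomial_sum_one]
    refine Finset.prod_congr rfl fun i _ => ?_
    simp [Matrix.mvPolynomialX_apply, X]
  rw [hprod, ← map_intCast (C : R →+* MvPolynomial (n × n) R), C_mul_monomial, mul_one]

/-- The coefficients of the determinant. [folklore] -/
theorem coeff_detPoly (d : (n × n) →₀ ℕ) :
    coeff d (detPoly n R) = ∑ ρ : Equiv.Perm n,
      if permMonomial ρ = d then (((Equiv.Perm.sign ρ : ℤˣ) : ℤ) : R) else 0 := by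
  rw [detPoly_eq_sum_monomial, coeff_sum]
  simp only [coeff_monomial]

/-- The permutation monomial `X^{μ_ρ}` has coefficient `sign ρ` in the determinant. [folklore] -/
theorem coeff_permMonomial_detPoly (ρ : Equiv.Perm n) :
    coeff (permMonomial ρ) (detPoly n R) = (((Equiv.Perm.sign ρ : ℤˣ) : ℤ) : R) := by
  rw [coeff_detPoly, Finset.sum_eq_single ρ]
  · simp
  · intro π _ hπ
    simp [permMonomial_injective.ne hπ]
  · simp

/-- The cast of `sign ρ = ±1` is a unit. [folklore] -/
theorem isUnit_intCast_sign (ρ : Equiv.Perm n) :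
    IsUnit ((((Equiv.Perm.sign ρ : ℤˣ) : ℤ) : R)) := by
  rcases Int.units_eq_one_or (Equiv.Perm.sign ρ) with h | h <;> simp [h]

/-- The cast of `sign ρ = ±1` is nonzero in a nontrivial ring. [folklore] -/
theorem intCast_sign_ne_zero [Nontrivial R] (ρ : Equiv.Perm n) :
    ((((Equiv.Perm.sign ρ : ℤˣ) : ℤ) : R)) ≠ 0 :=
  (isUnit_intCast_sign R ρ).ne_zero

/-- The support of the determinant consists of permutation monomials. [folklore] -/
theorem exists_permMonomial_eq_of_coeff_detPoly_ne_zero {d : (n × n) →₀ ℕ}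
    (h : coeff d (detPoly n R) ≠ 0) : ∃ ρ : Equiv.Perm n, permMonomial ρ = d := by
  by_contra hne
  push Not at hne
  apply h
  rw [coeff_detPoly]
  exact Finset.sum_eq_zero fun ρ _ => if_neg (hne ρ)

/-- Every variable has degree exactly `1` in the determinant. [folklore] -/
theorem degreeOf_detPoly [Nontrivial R] (v : n × n) : degreeOf v (detPoly n R) = 1 := by
  apply le_antisymm
  · rw [degreeOf_le_iff]
    intro d hd
    obtain ⟨ρ, rfl⟩ := exists_permMonomial_eq_of_coeff_detPoly_ne_zero R (mem_support_iff.1 hd)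
    obtain ⟨r, c⟩ := v
    rw [permMonomial_apply]
    split_ifs <;> simp
  · obtain ⟨r, c⟩ := v
    have hmem : permMonomial (Equiv.swap c r) ∈ (detPoly n R).support := by
      rw [mem_support_iff, coeff_permMonomial_detPoly]
      exact intCast_sign_ne_zero R _
    have := monomial_le_degreeOf (r, c) hmem
    rwa [permMonomial_apply, Equiv.swap_apply_left, if_pos rfl] at this

end Coeffs

/-! ### Irreducibility -/

section Irreducible

variable {n : Type*} [Fintype n] [DecidableEq n] {R : Type*} [CommRing R] [IsDomain R]

/-- Key step: if `g h = det`, then the set `S` of variables occurring in `g` is empty or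
everything (the argument of von zur Gathen 1987, Thm. 3.4, for the determinant). [folklore] -/
theorem vars_factor_detPoly_trivial {g h : MvPolynomial (n × n) R} (hgh : g * h = detPoly n R) :
    (∀ d ∈ g.support, d = 0) ∨ (∀ d ∈ h.support, d = 0) := by
  classical
  have hne : g * h ≠ 0 := by
    rw [hgh]; intro h0
    have := coeff_permMonomial_detPoly R (1 : Equiv.Perm n)
    rw [h0, coeff_zero] at this
    exact intCast_sign_ne_zero R (1 : Equiv.Perm n) this.symm
  have hg0 : g ≠ 0 := left_ne_zero_of_mul hne
  have hh0 : h ≠ 0 := right_ne_zero_of_mul hne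
  -- the variables split between `g` and `h`
  have hdeg : ∀ v, degreeOf v g + degreeOf v h = 1 := fun v => by
    rw [← degreeOf_mul_eq hg0 hh0, hgh, degreeOf_detPoly]
  set S : Finset (n × n) := Finset.univ.filter fun v => degreeOf v g ≠ 0 with hS
  have hgS : ∀ d ∈ g.support, ∀ v, d v ≠ 0 → v ∈ S := fun d hd v hv => by
    rw [hS, Finset.mem_filter]
    refine ⟨Finset.mem_univ _, fun h0 => hv ?_⟩
    have := monomial_le_degreeOf v hd
    omega
  have hhS : ∀ d ∈ h.support, ∀ v, d v ≠ 0 → v ∉ S := fun d hd v hv hvS => by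
    rw [hS, Finset.mem_filter] at hvS
    have h1 := monomial_le_degreeOf v hd
    have h2 := hdeg v
    omega
  -- (F1) every permutation monomial splits into a `g`-part and an `h`-part with non-zero coefficients
  have F1 : ∀ π : Equiv.Perm n,
      coeff ((permMonomial π).filter (· ∈ S)) g * coeff ((permMonomial π).filter (¬ · ∈ S)) h ≠ 0 :=
    fun π => by
      rw [← coeff_mul_of_separated S hgS hhS, hgh, coeff_permMonomial_detPoly]
      exact intCast_sign_ne_zero R π
  -- (F2) hybrid monomials are permutation monomials
  have F2 : ∀ π π' : Equiv.Perm n, ∃ ρ : Equiv.Perm n, permMonomial ρ =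
      (permMonomial π).filter (· ∈ S) + (permMonomial π').filter (¬ · ∈ S) := by
    intro π π'
    set ν := (permMonomial π).filter (· ∈ S) + (permMonomial π').filter (¬ · ∈ S) with hν
    have e1 : ν.filter (· ∈ S) = (permMonomial π).filter (· ∈ S) := by
      ext v; simp only [hν, Finsupp.filter_apply, Finsupp.add_apply]
      by_cases hv : v ∈ S <;> simp [hv]
    have e2 : ν.filter (¬ · ∈ S) = (permMonomial π').filter (¬ · ∈ S) := by
      ext v; simp only [hν, Finsupp.filter_apply, Finsupp.add_apply]
      by_cases hv : v ∈ S <;> simp [hv]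
    have hcoeff : coeff ν (g * h) ≠ 0 := by
      rw [coeff_mul_of_separated S hgS hhS, e1, e2]
      exact mul_ne_zero (left_ne_zero_of_mul (F1 π)) (right_ne_zero_of_mul (F1 π'))
    rw [hgh] at hcoeff
    exact exists_permMonomial_eq_of_coeff_detPoly_ne_zero R hcoeff
  -- (F3) rows: `S` is a union of full rows
  have F3 : ∀ r b b', (r, b) ∈ S → (r, b') ∈ S := by
    intro r b b' hrb
    obtain ⟨ρ, hρ⟩ := F2 (Equiv.swap b r) (Equiv.swap b' r)
    have := rowCount_permMonomial ρ r
    rw [hρ, rowCount_add, rowCount_filter_permMonomial, rowCount_filter_permMonomial,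
      Equiv.symm_swap, Equiv.symm_swap, Equiv.swap_apply_right, Equiv.swap_apply_right,
      if_pos hrb] at this
    by_contra hb'
    rw [if_pos hb'] at this
    omega
  -- (F4) columns: `S` is a union of full columns
  have F4 : ∀ c a a', (a, c) ∈ S → (a', c) ∈ S := by
    intro c a a' hac
    obtain ⟨ρ, hρ⟩ := F2 (Equiv.swap c a) (Equiv.swap c a')
    have := colCount_permMonomial ρ c
    rw [hρ, colCount_add, colCount_filter_permMonomial, colCount_filter_permMonomial,
      Equiv.swap_apply_left, Equiv.swap_apply_left, if_pos hac] at this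
    by_contra ha'
    rw [if_pos ha'] at this
    omega
  -- hence `S = ∅` or `S = univ`
  by_cases hSne : S.Nonempty
  · right
    obtain ⟨⟨a, b⟩, hab⟩ := hSne
    have hall : ∀ v : n × n, v ∈ S := fun ⟨i, j⟩ => F4 j a i (F3 a b j hab)
    intro d hd
    ext v
    by_contra hv
    exact hhS d hd v hv (hall v)
  · left
    intro d hd
    ext v
    by_contra hv
    exact hSne ⟨v, hgS d hd v hv⟩

/-- **The generic determinant is irreducible** over any integral domain, for every non-empty finite
index type (Jacobson, *Basic Algebra I*, §7.2; cf. von zur Gathen 1987, Thm. 3.4 for the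
permanent). [folklore] -/
theorem detPoly_irreducible [Nonempty n] : Irreducible (detPoly n R) := by
  classical
  refine ⟨fun hu => ?_, fun g h hgh => ?_⟩
  · -- not a unit: a unit has degree `0` in every variable
    obtain ⟨u, hu⟩ := hu
    obtain ⟨i⟩ := ‹Nonempty n›
    have h1 : degreeOf (i, i) (detPoly n R) = 1 := degreeOf_detPoly R (i, i)
    have hprod : (u : MvPolynomial (n × n) R) * (↑u⁻¹ : MvPolynomial (n × n) R) = 1 := by
      rw [← Units.val_mul, mul_inv_cancel, Units.val_one]
    have hu0 : (u : MvPolynomial (n × n) R) ≠ 0 := by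
      rw [hu]; intro h0; rw [h0, degreeOf_zero] at h1; exact zero_ne_one h1
    have hui0 : (↑u⁻¹ : MvPolynomial (n × n) R) ≠ 0 := fun h0 => by
      rw [h0, mul_zero] at hprod; exact zero_ne_one hprod
    have := degreeOf_mul_eq (n := (i, i)) hu0 hui0
    rw [hprod, degreeOf_one, hu, h1] at this
    omega
  · have hsign1 : (((Equiv.Perm.sign (1 : Equiv.Perm n) : ℤˣ) : ℤ) : R) = 1 := by simp
    rcases vars_factor_detPoly_trivial hgh.symm with hg | hh
    · left
      have hgC := eq_C_of_support_subset_zero hg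
      have key : coeff 0 g * coeff (permMonomial 1) h = 1 := by
        have := congrArg (coeff (permMonomial (1 : Equiv.Perm n))) hgh
        rw [coeff_permMonomial_detPoly, hsign1, hgC, coeff_C_mul] at this
        exact this.symm
      rw [hgC]
      exact (IsUnit.of_mul_eq_one _ key).map C
    · right
      have hhC := eq_C_of_support_subset_zero hh
      have key : coeff (permMonomial 1) g * coeff 0 h = 1 := by
        have := congrArg (coeff (permMonomial (1 : Equiv.Perm n))) hgh
        rw [coeff_permMonomial_detPoly, hsign1, hhC, mul_comm, coeff_C_mul] at this
        rw [mul_comm]; exact this.symm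
      rw [hhC]
      exact (IsUnit.of_mul_eq_one_right _ key).map C

/-- Over a field the generic determinant is a **prime** element of the factorial ring
`k[X_{ij}]` (irreducible elements of a unique factorisation monoid are prime). [folklore] -/
theorem detPoly_prime {k : Type*} [Field k] [Nonempty n] : Prime (detPoly n k) :=
  UniqueFactorizationMonoid.irreducible_iff_prime.mp (detPoly_irreducible (R := k))

/-! ### Determinants of matrices of distinct variables inside a larger polynomial ring -/

/-- **The determinant of a square matrix of distinct variables is irreducible** in any polynomial
ring `R[x_α]` over an integral domain containing these variables (and possibly more): splitting the
variables as `α ≃ (m × m) ⊕ β`, `R[x_α] ≅ (R[x_β])[X_{ij}]` carries it to the generic determinant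
over the domain `R[x_β]` (`detPoly_irreducible`). [folklore] -/
theorem irreducible_det_of_X {α : Type*} {m : Type*} [Fintype m] [DecidableEq m] [Nonempty m]
    {ι : m × m → α} (hι : Function.Injective ι) :
    Irreducible (Matrix.of fun i j => (X (ι (i, j)) : MvPolynomial α R)).det := by
  classical
  set s : Set α := Set.range ι with hs
  let e₁ : m × m ≃ s := Equiv.ofInjective ι hι
  let e : (m × m) ⊕ (sᶜ : Set α) ≃ α := (e₁.sumCongr (Equiv.refl _)).trans (Equiv.Set.sumCompl s)
  have he : ∀ x : m × m, e (Sum.inl x) = ι x := fun x => by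
    show (Equiv.Set.sumCompl s) (Sum.inl (e₁ x)) = ι x
    rw [Equiv.Set.sumCompl_apply_inl]
    rfl
  let φ : MvPolynomial α R ≃ₐ[R] MvPolynomial (m × m) (MvPolynomial (sᶜ : Set α) R) :=
    (renameEquiv R e.symm).trans (sumAlgEquiv R (m × m) (sᶜ : Set α))
  have hφX : ∀ x : m × m, φ (X (ι x)) = X x := fun x => by
    have h1 : e.symm (ι x) = Sum.inl x := by
      rw [Equiv.symm_apply_eq]; exact (he x).symm
    simp [φ, renameEquiv_apply, rename_X, h1, sumAlgEquiv_X_inl]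
  have hφ : φ (Matrix.of fun i j => (X (ι (i, j)) : MvPolynomial α R)).det =
      detPoly m (MvPolynomial (sᶜ : Set α) R) := by
    rw [AlgEquiv.map_det, detPoly]
    congr 1
    ext i j
    simp [AlgEquiv.mapMatrix_apply, Matrix.map_apply, hφX, Matrix.mvPolynomialX_apply]
  rw [← MulEquiv.irreducible_iff φ.toMulEquiv]
  change Irreducible (φ (Matrix.of fun i j => (X (ι (i, j)) : MvPolynomial α R)).det)
  rw [hφ]
  exact detPoly_irreducible

/-- Over a field, the determinant of a square matrix of distinct variables is a **prime** element of
the factorial ring `k[x_α]`. [folklore] -/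
theorem prime_det_of_X {k : Type*} [Field k] {α : Type*} {m : Type*} [Fintype m]
    [DecidableEq m] [Nonempty m] {ι : m × m → α} (hι : Function.Injective ι) :
    Prime (Matrix.of fun i j => (X (ι (i, j)) : MvPolynomial α k)).det :=
  UniqueFactorizationMonoid.irreducible_iff_prime.mp (irreducible_det_of_X hι)

end Irreducible

end Literature.Computability.AlgebraicComplexity
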